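import Mathlib
import HarnessLib
import Summits.Ventures.LatticeQCDFlow.Exactness.ReplicaProductInvariant
import Summits.Ventures.LatticeQCDFlow.Exactness.NCMCGeneralSpaceDoeblinPowerCLT
import Summits.Ventures.LatticeQCDFlow.Exactness.NCMCGeneralSpaceGammaMethodStudentizedCLT

/-!
# Replicas with DEPENDENT starts: `R` chains advanced independently in lockstep from ANY JOINT initial law (e.g. branched off one run) pool exactly like independent ones — `√(Rn) (x̄_{R,n} − πf) ⇒ N(0, σ²_f)`

HONEST FRAMING: exact (Metropolis-corrected) sampling algorithms for lattice gauge theory;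
figures of merit are autocorrelation/cost numbers at stated couplings and volumes; no
continuum-physics claim.

Venture `LatticeQCDFlow` (cell pub-lqcd), topic `Exactness`; FANOUT row 13 (`eng-snf`, GEN-24).  NEW
WORK of the cell; composition of row 9's replica-product kernels (`replicaLift` / `replicaSweep`,
`replicaSweep_minorised`, `invariant_pi_replicaSweep` — `ReplicaProductDoeblin` /
`ReplicaProductInvariant`), GEN-19's CLT for one Doeblin-power chain from ANY initial law
(`tendstoInDistribution_timeAverage_of_nHit`) and row 11/GEN-20's transition-operator calculus
(`Scoring.kop`, `Scoring.autocov`, `cltVariance_eq_autocov`).  No definition; nothing cited as a fact.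

WHY (row 13).  Every replica-pooling statement of GEN-23/24 (R2 `NCMCGeneralSpaceReplicaPooledCLT` and
its descendants) assumes INDEPENDENT replicas — the product law `⊗_r P_{μ_r}` — and lists
"dependent replicas (streams branched off one run)" as NOT CLAIMED.  In practice the `R` streams of a
batch are often started from configurations taken off ONE equilibration run, i.e. from a DEPENDENT
joint start, and then advanced independently.  That process is the PRODUCT CHAIN on `S^R`: one step
updates every replica by its own draw from `κ` (row 9's `replicaSweep (fun _ ↦ κ)` over a list
enumerating the replicas), started from an ARBITRARY joint law `μ` on `S^R`.  This file proves that
the pooled time average along that chain satisfies the same CLT as for independent starts: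
`√(Rn) (x̄_{R,n} − πf) ⇒ N(0, σ²_f)` from EVERY joint initial law `μ` — dependence of the starts
is washed out exactly like the starts themselves.

## Content
* `integral_replicaLift` (§1) — `∫ g d(replicaLift K r ω) = ∫ g(ω[r ↦ y]) K_r(ω_r, dy)`;
  `kop_replicaLift_comp_eval_of_ne` / `kop_replicaLift_comp_eval_self` — the lift of `K_r` fixes every
  observable of another coordinate and acts as `K_r` on observables of coordinate `r`;
  **`kop_replicaSweep_comp_eval`** — along a duplicate-free sweep through `L ∋ s`,
  `kop (replicaSweep K L) (h ∘ eval_s) = (kop (K s) h) ∘ eval_s`; `iterate_kop_replicaSweep_comp_eval`;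
  `iterate_kop_finset_sum` (linearity of the iterated transition operator on bounded observables).
* **`autocov_replicaSweep_sum_eq`** (§2) — under `⊗_r π`, for `f̄` bounded measurable with
  `∫ f̄ dπ = 0`: `autocov Q (⊗π) (Σ_r f̄ ∘ eval_r) t = R · autocov κ π f̄ t` (cross terms vanish by
  independence of the coordinates).
* **`tendstoInDistribution_pooledSum_productChain`** (§3) — `κ` Markov, `π` invariant,
  `κ(z,·) ≥ ε ν` (`ε ≠ 0`), `|f| ≤ C`; `Q = replicaSweep (fun _ ↦ κ) L` for any duplicate-free list `L`
  through every replica; for EVERY probability law `μ` on `ι → S` and every `Y ~ N(0, σ²_f)`: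
  `(√(Rn))⁻¹ Σ_{t<n} Σ_r (f(X_t r) − πf) ⇒ Y` under the product-chain law from `μ`;
  **`tendstoInDistribution_sqrt_mul_pooledMean_sub_productChain`** — the `√(Rn)(x̄_{R,n} − πf)` form.

NOT CLAIMED: replicas that INTERACT after the start (swaps — that is PTBC, rows 21–23); a Doeblin
POWER instead of the one-step minorisation (row 9's sweep certificate is one-step); unequal lengths
with dependent starts; anything numerical.
-/

namespace Summit.Ventures.LatticeQCDFlow.Exactness.GeneralNCMC

open MeasureTheory ProbabilityTheory Set Filter Finset Function
open Summit.Ventures.LatticeQCDFlow.Exactness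
open scoped ENNReal NNReal Topology

/-! ## §1 The transition operator of the replica sweep on one-coordinate observables -/

section Operator

variable {ι : Type*} [DecidableEq ι] {S : Type*} [MeasurableSpace S]
  {K : ι → Kernel S S} [∀ r, IsMarkovKernel (K r)]

/-- `∫ g d(replicaLift K r ω) = ∫ g(ω[r ↦ y]) K_r(ω_r, dy)`. -/
theorem integral_replicaLift (r : ι) (ω : ι → S) {g : (ι → S) → ℝ} (hg : Measurable g) :
    ∫ ω', g ω' ∂(replicaLift K r ω) = ∫ y, g (update ω r y) ∂(K r (ω r)) := by
  rw [replicaLift, siteLift_apply, Kernel.comap_apply,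
    integral_map (measurable_update ω).aemeasurable hg.aestronglyMeasurable]

/-- The lift of `K r` FIXES every observable of another coordinate `s ≠ r`. -/
theorem kop_replicaLift_comp_eval_of_ne {r s : ι} (hrs : s ≠ r) {h : S → ℝ} (hh : Measurable h) :
    Scoring.kop (replicaLift K r) (fun ω : ι → S => h (ω s)) = fun ω => h (ω s) := by
  funext ω
  unfold Scoring.kop
  rw [integral_replicaLift (g := fun ω : ι → S => h (ω s)) r ω
    (by exact hh.comp (measurable_pi_apply s))]
  simp only [update_of_ne hrs, integral_const, probReal_univ, one_smul]

/-- The lift of `K r` acts as `K r` on observables of coordinate `r`. -/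
theorem kop_replicaLift_comp_eval_self (r : ι) {h : S → ℝ} (hh : Measurable h) :
    Scoring.kop (replicaLift K r) (fun ω : ι → S => h (ω r))
      = fun ω => Scoring.kop (K r) h (ω r) := by
  funext ω
  unfold Scoring.kop
  rw [integral_replicaLift (g := fun ω : ι → S => h (ω r)) r ω
    (by exact hh.comp (measurable_pi_apply r))]
  simp only [update_self]

/-- **Along a duplicate-free sweep, an observable of coordinate `s` is moved by `K s` alone**:
`kop (replicaSweep K L) (h ∘ eval_s) = (kop (K s) h) ∘ eval_s` if `s ∈ L`, and `= h ∘ eval_s` if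
`s ∉ L` (`h` bounded measurable). -/
theorem kop_replicaSweep_comp_eval {L : List ι} (hL : L.Nodup) (s : ι) {h : S → ℝ}
    (hh : Measurable h) {C : ℝ} (hC : ∀ y, |h y| ≤ C) :
    Scoring.kop (replicaSweep K L) (fun ω : ι → S => h (ω s))
      = if s ∈ L then (fun ω => Scoring.kop (K s) h (ω s)) else fun ω => h (ω s) := by
  induction L generalizing h with
  | nil =>
    simp only [List.not_mem_nil, if_false, replicaSweep, List.map_nil, cycle_nil]
    funext ω
    simp only [Scoring.kop, Kernel.id_apply]
    exact integral_dirac' _ _ ((hh.comp (measurable_pi_apply s)).stronglyMeasurable)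
  | cons r L ih =>
    have hnd : L.Nodup := (List.nodup_cons.1 hL).2
    have hrL : r ∉ L := (List.nodup_cons.1 hL).1
    have hstep : replicaSweep K (r :: L) = replicaLift K r ∘ₖ replicaSweep K L := by
      simp [replicaSweep, cycle_cons]
    rw [hstep, Scoring.kop_comp (replicaSweep K L) (replicaLift K r)
      (g := fun ω : ι → S => h (ω s)) (by exact hh.comp (measurable_pi_apply s))
      (fun ω => hC (ω s))]
    by_cases hsr : s = r
    · subst hsr
      rw [kop_replicaLift_comp_eval_self s hh, ih hnd (Scoring.measurable_kop (K s) hh)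
        (Scoring.abs_kop_le (K s) hC)]
      simp only [List.mem_cons, true_or, if_true, hrL, if_false]
    · rw [kop_replicaLift_comp_eval_of_ne hsr hh, ih hnd hh hC]
      simp only [List.mem_cons, hsr, false_or]

/-- Iterated: `(kop Q)^[t] (h ∘ eval_s) = ((kop (K s))^[t] h) ∘ eval_s` for `s ∈ L`. -/
theorem iterate_kop_replicaSweep_comp_eval {L : List ι} (hL : L.Nodup) {s : ι} (hs : s ∈ L)
    {h : S → ℝ} (hh : Measurable h) {C : ℝ} (hC : ∀ y, |h y| ≤ C) :
    ∀ t : ℕ, (Scoring.kop (replicaSweep K L))^[t] (fun ω : ι → S => h (ω s))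
      = fun ω => (Scoring.kop (K s))^[t] h (ω s)
  | 0 => rfl
  | t + 1 => by
    obtain ⟨hm, hb⟩ := Scoring.iterate_kop_bounded_measurable (K s) hh hC t
    rw [Function.iterate_succ_apply', iterate_kop_replicaSweep_comp_eval hL hs hh hC t,
      kop_replicaSweep_comp_eval hL s hm hb, if_pos hs, Function.iterate_succ_apply']

omit [DecidableEq ι] [∀ r, IsMarkovKernel (K r)] in
/-- The iterated transition operator of a Markov kernel is additive over finite sums of bounded
measurable observables. -/
theorem iterate_kop_finset_sum {T : Type*} [MeasurableSpace T] (Q : Kernel T T) [IsMarkovKernel Q]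
    (A : Finset ι) {g : ι → T → ℝ} (hg : ∀ r, Measurable (g r)) {C : ℝ} (hC : ∀ r x, |g r x| ≤ C) :
    ∀ t : ℕ, (Scoring.kop Q)^[t] (fun x => ∑ r ∈ A, g r x)
      = fun x => ∑ r ∈ A, (Scoring.kop Q)^[t] (g r) x
  | 0 => rfl
  | t + 1 => by
    rw [Function.iterate_succ_apply', iterate_kop_finset_sum Q A hg hC t]
    funext x
    unfold Scoring.kop
    rw [integral_finsetSum _ fun r _ => ?_]
    · simp only [Function.iterate_succ_apply']
    · obtain ⟨hm, hb⟩ := Scoring.iterate_kop_bounded_measurable Q (hg r) (hC r) t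
      exact Scoring.integrable_of_bounded _ hm hb

end Operator

/-! ## §2 Autocovariances of the pooled observable under the product law -/

section Autocov

variable {ι : Type*} [DecidableEq ι] [Fintype ι] {S : Type*} [MeasurableSpace S]
  {κ : Kernel S S} [IsMarkovKernel κ] {π : Measure S} [IsProbabilityMeasure π]

omit [DecidableEq ι] in
/-- One-coordinate observables integrate against the product law as against the factor. -/
theorem integral_comp_eval_pi_fintype (r : ι) {h : S → ℝ} (hh : Measurable h) :
    ∫ ω, h (ω r) ∂(Measure.pi fun _ : ι => π) = ∫ y, h y ∂π :=
  integral_comp_of_measurePreserving (measurePreserving_eval (fun _ : ι => π) r)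
    hh.aestronglyMeasurable

omit [DecidableEq ι] in
/-- Cross terms vanish: for `r ≠ s` and `∫ g dπ = 0`,
`∫ g(ω r) · A(ω s) d(⊗π) = 0` (independence of the coordinates under the product law). -/
theorem integral_mul_comp_eval_of_ne {r s : ι} (hrs : r ≠ s) {g A : S → ℝ} (hg : Measurable g)
    (hA : Measurable A) (hg0 : ∫ y, g y ∂π = 0) :
    ∫ ω, g (ω r) * A (ω s) ∂(Measure.pi fun _ : ι => π) = 0 := by
  have hind : IndepFun (fun ω : ι → S => g (ω r)) (fun ω : ι → S => A (ω s))
      (Measure.pi fun _ : ι => π) := by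
    have h0 : iIndepFun (fun i (ω : ι → S) => ω i) (Measure.pi fun _ : ι => π) :=
      iIndepFun_pi (X := fun _ => id) fun _ => aemeasurable_id
    exact (h0.indepFun hrs).comp hg hA
  rw [hind.integral_fun_mul_eq_mul_integral (hg.comp (measurable_pi_apply r)).aestronglyMeasurable
    (hA.comp (measurable_pi_apply s)).aestronglyMeasurable, integral_comp_eval_pi_fintype r hg, hg0,
    zero_mul]

/-- **`C_{Σ_r g∘eval_r}(t) = R · C_g(t)` along the replica sweep under the product law**: `L` a
duplicate-free list through every replica, `g` bounded measurable with `∫ g dπ = 0`. -/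
theorem autocov_replicaSweep_sum_eq {L : List ι} (hL : L.Nodup) (hLall : ∀ r, r ∈ L)
    {g : S → ℝ} (hg : Measurable g) {C : ℝ} (hC : ∀ y, |g y| ≤ C) (hg0 : ∫ y, g y ∂π = 0) (t : ℕ) :
    Scoring.autocov (replicaSweep (fun _ : ι => κ) L) (Measure.pi fun _ : ι => π)
        (fun ω : ι → S => ∑ r, g (ω r)) t
      = Fintype.card ι * Scoring.autocov κ π g t := by
  obtain ⟨hAm, hAb⟩ := Scoring.iterate_kop_bounded_measurable κ hg hC t
  set A := (Scoring.kop κ)^[t] g with hA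
  have hC0 : 0 ≤ C :=
    (abs_nonneg _).trans (hC (Classical.choice (nonempty_of_isProbabilityMeasure π)))
  unfold Scoring.autocov
  -- the iterated operator acts coordinatewise on the sum
  have hiter : (Scoring.kop (replicaSweep (fun _ : ι => κ) L))^[t] (fun ω : ι → S => ∑ r, g (ω r))
      = fun ω => ∑ r, A (ω r) := by
    rw [iterate_kop_finset_sum (replicaSweep (fun _ : ι => κ) L) univ
      (g := fun r (ω : ι → S) => g (ω r)) (fun r => hg.comp (measurable_pi_apply r))
      (fun r ω => hC (ω r)) t]
    funext ω
    refine sum_congr rfl fun r _ => ?_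
    rw [iterate_kop_replicaSweep_comp_eval (K := fun _ : ι => κ) hL (hLall r) hg hC t]
  rw [hiter, ← hA]
  -- expand the product of sums and integrate term by term
  have hprod : (fun ω : ι → S => (∑ r, g (ω r)) * ∑ s, A (ω s))
      = fun ω => ∑ r, ∑ s, g (ω r) * A (ω s) := by
    funext ω; rw [sum_mul_sum]
  have hint : ∀ r s, Integrable (fun ω : ι → S => g (ω r) * A (ω s)) (Measure.pi fun _ : ι => π) :=
    fun r s => Scoring.integrable_of_bounded _
      ((hg.comp (measurable_pi_apply r)).mul (hAm.comp (measurable_pi_apply s))) (C := C * C)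
      fun ω => by rw [abs_mul]; exact mul_le_mul (hC _) (hAb _) (abs_nonneg _) hC0
  rw [hprod, integral_finsetSum _ fun r _ => integrable_finsetSum _ fun s _ => hint r s]
  simp_rw [integral_finsetSum _ fun s _ => hint _ s]
  -- diagonal terms are `C_g(t)`, off-diagonal terms vanish
  have hterm : ∀ r s, ∫ ω, g (ω r) * A (ω s) ∂(Measure.pi fun _ : ι => π)
      = if r = s then ∫ y, g y * A y ∂π else 0 := by
    intro r s
    split_ifs with h
    · subst h
      exact integral_comp_eval_pi_fintype r (hg.mul hAm)
    · exact integral_mul_comp_eval_of_ne h hg hAm hg0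
  simp_rw [hterm, sum_ite_eq, Finset.mem_univ, if_true, sum_const, card_univ, nsmul_eq_mul]

end Autocov

/-! ## §3 The pooled CLT for the product chain from ANY joint initial law -/

section CLT

variable {ι : Type*} [DecidableEq ι] [Fintype ι] [Nonempty ι] {S : Type*} [MeasurableSpace S]
  {κ : Kernel S S} [IsMarkovKernel κ] {π : Measure S} [IsProbabilityMeasure π]
  {ν : Measure S} [IsProbabilityMeasure ν] {ε : ℝ≥0∞}

/-- **REPLICAS WITH DEPENDENT STARTS POOL LIKE INDEPENDENT ONES.**  `κ` Markov, `π` invariant,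
`κ(z, ·) ≥ ε ν` for all `z` (`ε ≠ 0`); `L` a duplicate-free list through every replica and
`Q = replicaSweep (fun _ ↦ κ) L` the product chain (every replica updated by its own draw from `κ`);
`|f| ≤ C` measurable; `μ` ANY probability law on `ι → S` (the joint start).  For every real random
variable `Y` with law `N(0, σ²_f)`:
`(√(Rn))⁻¹ Σ_{t<n} Σ_r (f(X_t(r)) − πf) ⇒ Y` under the law of the product chain started from `μ`. -/
theorem tendstoInDistribution_pooledSum_productChain (hπ : Kernel.Invariant κ π) (hε : ε ≠ 0)
    (hmin : ∀ z, ε • ν ≤ κ z) {L : List ι} (hL : L.Nodup) (hLall : ∀ r, r ∈ L)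
    {f : S → ℝ} (hf : Measurable f) {C : ℝ} (hC : ∀ x, |f x| ≤ C)
    (μ : Measure (ι → S)) [IsProbabilityMeasure μ]
    {Ω' : Type*} [MeasurableSpace Ω'] {P' : Measure Ω'} [IsProbabilityMeasure P'] {Y : Ω' → ℝ}
    (hY : HasLaw Y (gaussianReal 0 (Real.toNNReal (Scoring.autocov κ π (fun y => f y - ∫ z, f z ∂π) 0
        + 2 * ∑' t, Scoring.autocov κ π (fun y => f y - ∫ z, f z ∂π) (t + 1)))) P')
    [IsProbabilityMeasure (Kernel.trajMeasure (X := fun _ : ℕ => ι → S) μ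
        (fun n : ℕ => (replicaSweep (fun _ : ι => κ) L).comap
          (fun hh : (i : ↥(Finset.Iic n)) → ι → S => hh ⟨n, Finset.mem_Iic.2 le_rfl⟩)
          (measurable_pi_apply _)))] :
    TendstoInDistribution (fun (n : ℕ) (x : ℕ → ι → S) =>
        (Real.sqrt ((Fintype.card ι : ℝ) * n))⁻¹ * ∑ t ∈ range n, ∑ r, (f (x t r) - ∫ z, f z ∂π))
      atTop Y (fun _ => Kernel.trajMeasure (X := fun _ : ℕ => ι → S) μ
        (fun n : ℕ => (replicaSweep (fun _ : ι => κ) L).comap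
          (fun hh : (i : ↥(Finset.Iic n)) → ι → S => hh ⟨n, Finset.mem_Iic.2 le_rfl⟩)
          (measurable_pi_apply _))) P' := by
  set Q : Kernel (ι → S) (ι → S) := replicaSweep (fun _ : ι => κ) L with hQ
  set Pπ : Measure (ι → S) := Measure.pi fun _ : ι => π with hPπ
  set R : ℕ := Fintype.card ι with hRdef
  have hR : (0 : ℝ) < R := by rw [hRdef]; exact_mod_cast Fintype.card_pos
  -- invariance and the one-step Doeblin certificate of the product chain (row 9)
  have hQπ : Kernel.Invariant Q Pπ := invariant_pi_replicaSweep (fun _ => hπ) L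
  have hεL : ε ^ L.length ≠ 0 := pow_ne_zero _ hε
  have hminQ : ∀ ω, ε ^ L.length • (Measure.pi fun _ : ι => ν) ≤ nHit Q 1 ω := fun ω => by
    rw [nHit_one]
    exact replicaSweep_minorised (K := fun _ : ι => κ) (ν := fun _ : ι => ν) (fun _ x => hmin x)
      hLall ω
  -- the pooled observable
  set F : (ι → S) → ℝ := fun ω => ∑ r, f (ω r) with hF
  have hC0 : 0 ≤ C :=
    (abs_nonneg _).trans (hC (Classical.choice (nonempty_of_isProbabilityMeasure π)))
  have hFm : Measurable F := by
    rw [hF]; exact Finset.measurable_sum _ fun r _ => hf.comp (measurable_pi_apply r)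
  have hFC : ∀ ω, |F ω| ≤ R * C := fun ω => by
    rw [hF]
    calc |∑ r, f (ω r)| ≤ ∑ r, |f (ω r)| := abs_sum_le_sum_abs _ _
      _ ≤ ∑ _r : ι, C := sum_le_sum fun r _ => hC _
      _ = R * C := by rw [sum_const, card_univ, nsmul_eq_mul]
  have hFmean : ∫ ω, F ω ∂Pπ = R * ∫ z, f z ∂π := by
    have hint : ∀ r : ι, Integrable (fun ω : ι → S => f (ω r)) Pπ := fun r =>
      Scoring.integrable_of_bounded _ (hf.comp (measurable_pi_apply r)) fun ω => hC (ω r)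
    have h1 : ∫ ω, F ω ∂Pπ = ∑ r : ι, ∫ ω, f (ω r) ∂Pπ :=
      calc ∫ ω, F ω ∂Pπ = ∫ ω, ∑ r, f (ω r) ∂Pπ := rfl
        _ = ∑ r, ∫ ω, f (ω r) ∂Pπ := integral_finsetSum _ fun r _ => hint r
    rw [h1]
    simp_rw [hPπ, integral_comp_eval_pi_fintype _ hf]
    rw [sum_const, card_univ, nsmul_eq_mul]
  -- the centred pooled observable is the sum of the centred one-coordinate observables
  set g : S → ℝ := fun y => f y - ∫ z, f z ∂π with hg
  have hgm : Measurable g := hf.sub measurable_const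
  have hgC : ∀ y, |g y| ≤ 2 * C := fun y => by
    rw [hg]
    have h1 := hC y
    have h2 : |∫ z, f z ∂π| ≤ C := by
      rw [← Real.norm_eq_abs]
      calc ‖∫ z, f z ∂π‖ ≤ C * π.real univ := norm_integral_le_of_norm_le_const
            (Eventually.of_forall fun z => by rw [Real.norm_eq_abs]; exact hC z)
        _ = C := by rw [probReal_univ, mul_one]
    calc |f y - ∫ z, f z ∂π| ≤ |f y| + |∫ z, f z ∂π| := abs_sub _ _
      _ ≤ 2 * C := by linarith
  have hg0 : ∫ y, g y ∂π = 0 := by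
    rw [hg, integral_sub (Scoring.integrable_of_bounded π hf hC) (integrable_const _), integral_const,
      probReal_univ, one_smul, sub_self]
  have hFbar : (fun ω : ι → S => F ω - ∫ z, F z ∂Pπ) = fun ω => ∑ r, g (ω r) := by
    funext ω
    rw [hFmean, hF, hg, sum_sub_distrib, sum_const, card_univ, nsmul_eq_mul]
  -- the Green–Kubo variance of `F` along `Q` is `R σ²_f`
  have hvar : (∫ ω, (F ω - ∫ z, F z ∂Pπ) ^ 2 ∂Pπ)
      + 2 * ∑' k, ∫ ω, (F ω - ∫ z, F z ∂Pπ)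
        * (Scoring.kop Q)^[k + 1] (fun ω => F ω - ∫ z, F z ∂Pπ) ω ∂Pπ
      = R * (Scoring.autocov κ π g 0 + 2 * ∑' t, Scoring.autocov κ π g (t + 1)) := by
    rw [cltVariance_eq_autocov Q Pπ F, hFbar]
    simp_rw [hQ, hPπ, autocov_replicaSweep_sum_eq (κ := κ) hL hLall hgm hgC hg0]
    rw [tsum_mul_left]
    ring
  -- GEN-19's CLT for `F` along `Q` from `μ`, against `√R · Y`
  have hYR : HasLaw (fun ω' => Real.sqrt R * Y ω') (gaussianReal 0 (Real.toNNReal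
      ((∫ ω, (F ω - ∫ z, F z ∂Pπ) ^ 2 ∂Pπ)
      + 2 * ∑' k, ∫ ω, (F ω - ∫ z, F z ∂Pπ)
        * (Scoring.kop Q)^[k + 1] (fun ω => F ω - ∫ z, F z ∂Pπ) ω ∂Pπ))) P' := by
    rw [hvar]
    have h := gaussianReal_const_mul hY (Real.sqrt R)
    rw [mul_zero] at h
    convert h using 2
    rw [Real.toNNReal_mul hR.le]
    congr 1
    apply NNReal.eq
    simp [Real.sq_sqrt hR.le]
  have hclt := tendstoInDistribution_timeAverage_of_nHit hQπ hεL hminQ Nat.one_pos hFm hFC μ hYR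
  -- divide by `√R`
  have hdiv := hclt.continuous_comp (g := fun y : ℝ => (Real.sqrt R)⁻¹ * y) (by fun_prop)
  have hlim : (fun y : ℝ => (Real.sqrt R)⁻¹ * y) ∘ (fun ω' => Real.sqrt R * Y ω') = Y := by
    funext ω'
    simp only [Function.comp_apply]
    rw [← mul_assoc, inv_mul_cancel₀ (Real.sqrt_pos.2 hR).ne', one_mul]
  rw [hlim] at hdiv
  refine hdiv.congr (fun n => Eventually.of_forall fun x => ?_) Filter.EventuallyEq.rfl
  simp only [Function.comp_apply]
  rw [Real.sqrt_mul (Nat.cast_nonneg _), mul_inv, mul_assoc]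
  congr 1
  congr 1
  refine sum_congr rfl fun t _ => ?_
  rw [hFmean, hF, sum_sub_distrib, sum_const, card_univ, nsmul_eq_mul]

omit [DecidableEq ι] in
/-- `(√(Rn))⁻¹ Σ_{t<n} Σ_r (a t r − c) = √(Rn) ((Σ_{t<n} Σ_r a t r)/(Rn) − c)` (both sides vanish at
`n = 0`). -/
theorem invSqrt_mul_sum_sum_sub_eq_sqrt_mul (a : ℕ → ι → ℝ) (c : ℝ) (n : ℕ) :
    (Real.sqrt ((Fintype.card ι : ℝ) * n))⁻¹ * ∑ t ∈ range n, ∑ r, (a t r - c)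
      = Real.sqrt ((Fintype.card ι : ℝ) * n)
        * ((∑ t ∈ range n, ∑ r, a t r) / ((Fintype.card ι : ℝ) * n) - c) := by
  rcases Nat.eq_zero_or_pos n with hn | hn
  · subst hn; simp
  · have hRpos : 0 < (Fintype.card ι : ℝ) := by exact_mod_cast Fintype.card_pos
    have hM : 0 < (Fintype.card ι : ℝ) * n := by positivity
    set M : ℝ := (Fintype.card ι : ℝ) * n with hMdef
    have hsum : ∑ t ∈ range n, ∑ r, (a t r - c) = (∑ t ∈ range n, ∑ r, a t r) - M * c := by
      simp only [Finset.sum_sub_distrib, Finset.sum_const, Finset.card_univ, Finset.card_range,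
        nsmul_eq_mul, hMdef]
      ring
    rw [hsum]
    have hM0 : M ≠ 0 := hM.ne'
    calc (Real.sqrt M)⁻¹ * ((∑ t ∈ range n, ∑ r, a t r) - M * c)
        = (Real.sqrt M / M) * ((∑ t ∈ range n, ∑ r, a t r) - M * c) := by rw [Real.sqrt_div_self]
      _ = Real.sqrt M * (((∑ t ∈ range n, ∑ r, a t r) - M * c) / M) := by ring
      _ = Real.sqrt M * ((∑ t ∈ range n, ∑ r, a t r) / M - c) := by
          rw [sub_div, mul_div_cancel_left₀ c hM0]

/-- **THE POOLED MEAN OF THE PRODUCT CHAIN FROM ANY JOINT START IS ASYMPTOTICALLY NORMAL AT THE POOLED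
SAMPLE SIZE**: `x̄_{R,n} = (Σ_{t<n} Σ_r f(X_t(r)))/(Rn)`, `√(Rn) (x̄_{R,n} − πf) ⇒ N(0, σ²_f)` — the
same error bar `√(σ²_f/(Rn))` as for independent starts, whatever the dependence of the starts. -/
theorem tendstoInDistribution_sqrt_mul_pooledMean_sub_productChain (hπ : Kernel.Invariant κ π)
    (hε : ε ≠ 0) (hmin : ∀ z, ε • ν ≤ κ z) {L : List ι} (hL : L.Nodup) (hLall : ∀ r, r ∈ L)
    {f : S → ℝ} (hf : Measurable f) {C : ℝ} (hC : ∀ x, |f x| ≤ C)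
    (μ : Measure (ι → S)) [IsProbabilityMeasure μ]
    {Ω' : Type*} [MeasurableSpace Ω'] {P' : Measure Ω'} [IsProbabilityMeasure P'] {Y : Ω' → ℝ}
    (hY : HasLaw Y (gaussianReal 0 (Real.toNNReal (Scoring.autocov κ π (fun y => f y - ∫ z, f z ∂π) 0
        + 2 * ∑' t, Scoring.autocov κ π (fun y => f y - ∫ z, f z ∂π) (t + 1)))) P')
    [IsProbabilityMeasure (Kernel.trajMeasure (X := fun _ : ℕ => ι → S) μ
        (fun n : ℕ => (replicaSweep (fun _ : ι => κ) L).comap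
          (fun hh : (i : ↥(Finset.Iic n)) → ι → S => hh ⟨n, Finset.mem_Iic.2 le_rfl⟩)
          (measurable_pi_apply _)))] :
    TendstoInDistribution (fun (n : ℕ) (x : ℕ → ι → S) =>
        Real.sqrt ((Fintype.card ι : ℝ) * n)
          * ((∑ t ∈ range n, ∑ r, f (x t r)) / ((Fintype.card ι : ℝ) * n) - ∫ z, f z ∂π))
      atTop Y (fun _ => Kernel.trajMeasure (X := fun _ : ℕ => ι → S) μ
        (fun n : ℕ => (replicaSweep (fun _ : ι => κ) L).comap
          (fun hh : (i : ↥(Finset.Iic n)) → ι → S => hh ⟨n, Finset.mem_Iic.2 le_rfl⟩)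
          (measurable_pi_apply _))) P' := by
  have h := tendstoInDistribution_pooledSum_productChain hπ hε hmin hL hLall hf hC μ hY
  refine h.congr (fun n => Eventually.of_forall fun x => ?_) Filter.EventuallyEq.rfl
  exact invSqrt_mul_sum_sum_sub_eq_sqrt_mul (fun t r => f (x t r)) (∫ z, f z ∂π) n

end CLT

end Summit.Ventures.LatticeQCDFlow.Exactness.GeneralNCMC
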